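import Summits.QuantumFields.BalabanUV.Beta.CombChartSpreadBlind
import Summits.QuantumFields.BalabanUV.Beta.CombRootedAbsorbsSym

/-!
# `BalabanUV.Beta.CombChartSpreadSymBlind` — binder row D1, RULING R-D1-g35-1 (hR repair route (β) = CHART (III′)), brick B2 part **K2**:
# THE (0.4)-SYMMETRISED LEGGED BORDER `bhK + Dsh` AND THE SHIFTED SPREAD `bhKStepSh d Lc (Dsh Lc) j` ARE BLIND, ON BOTH SIDES,
# TO THE ROOTED SYMMETRISED DRESSING `piKSym (ctr (d+1) Lc) Lc` (every level `j`; the twin of B1 `CombChartSpreadBlind` with the SYM root gauge)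

HONEST FRAMING (cell charter, verbatim): «discharging `BetaPertH` makes Bałaban's UV stability UNCONDITIONAL — a real constructive-QFT
result; it is NOT the continuum limit and NOT the Clay problem.»  HONEST DEPENDENCY (verbatim): «continuum YM on T⁴ ⇐ BetaPertH ∧ nine
spine estimates (0/9 proved); BetaPertH ⇐ (D1) ∧ (D4) ∧ CAP+tail; G-an2-4 gates asym, D1 and NE2/3/4.»  THIS MODULE DISCHARGES NOTHING of
row D1 ∕ `BetaPertH`: [folklore] kernel bookkeeping over OUR objects (`piKSym`, `symAxProjAt`, `symGaugeAt`, `bhK`, `Dsh`, `bhKStepSh`).  No `def`,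
no `def … : Prop`, nothing cited, 0 sorry.  K2 is ONE input (the hypotheses `hMS` ∕ `hStM` of the owner's `RelInvBlindTransport.relInv_transport_of_blind`
at `S := trK (piKSym (ctr) Lc)`, `St := piKSym (ctr) Lc`) of brick P2; it does NOT prove P2, does NOT repair hR.  NOT D1, NOT BetaPertH, NOT continuum, NOT Clay.

ABSOLUTE RULE (cell, verbatim): «No internally-minted statement may enter as a cited fact. Every hypothesis is either kernel-proved in this
package or a verbatim quotation of a PUBLISHED theorem with page reference.»

WHY (owner an2 g35 OFFER l.36838 ∕ l.36919 ∕ AMEND1 l.36993; an3 g78 W-an3-g78-1 (V1)–(V3)).  The legged border `±[coarse]·((d+1)!)⁻¹·symLinAvgAt ρ_c`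
of `bhK + Dsh` is the functional `((d+1)!)⁻¹·symLinAvgAt ρ_c` on column forms (B1's `comp_bhK_add_Dsh_inr`), and the (0.4) rooted averaging is
blind to the ROOTED symmetrised projector at the same root (tree `SymmetrisedAxialGauge.symLinAvgAt_symAxProjAt`); the field rows (`d*d` at `j = 0`,
the bounded co-closed `wVH·wΦ` at `j + 1`) kill the gradient correction `grad (symGaugeAt ρ_c δ)` (finitely supported:
`SymBorderedHessianStepBlind.symGaugeAt_delta1_eq_zero_of_blk_ne`); multiplier columns are untouched; LEFT from RIGHT by `trK = sgnK`.
CONTENT (the columns of `trK (piKSym (toSite r) N)` are in `CombRootedAbsorbsSym` §2, over the owner's `SymRootedDressingKernel`): §2 `j = 0`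
**`comp_bhKSym_trK_piKSym` ∕ `comp_piKSym_bhKSym`**; §3 `j + 1` **`comp_bhKStepSh_succ_trK_piKSym` ∕ `comp_piKSym_bhKStepSh_succ`**, wrappers
`comp_bhKStepSh_trK_piKSym` ∕ `comp_piKSym_bhKStepSh` (every `j`).  Patterns: `CombChartSpreadBlind` (this seat), `SymBorderedHessianStepBlind` (an2 g25).
Unit `b2b-balaban-beta-d1-formalise-leaf-03` gen 19 (D1 formalisation swarm), 2026-08-21; row-D1 owner `b2b-balaban-beta-an2`.
-/

noncomputable section

open Finset
open scoped BigOperators Nat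
open Literature.Probability.LatticeModels (Torus.proj)
open Literature.MathematicalPhysics.QuantumFieldTheory
open Literature.MathematicalPhysics.QuantumFieldTheory.Balaban1983to89
open Literature.MathematicalPhysics.QuantumFieldTheory.Balaban1983to89.Beta
open ExpKernelCalculus (MKer comp)
open AffineAveraging (Form0 Form1 Site box toSite unitVec curv curvAdj)
open AveragingContoursRooted (ctr ctrOff ctrOff_mem_box)
open KKTFluctuationKernel (delta1)
open KernelSpecInstance (wΦ)
open LatticeForm (quo)
open OneStepResolventKernel (Fib)
open BalabanStepJetsSucc (wVH)
open Summit.QuantumFields.BalabanUV.Beta.TameKernelCalculus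
open Summit.QuantumFields.BalabanUV.Beta.AxialDressingRooted (one_le_of_neZero)
open Summit.QuantumFields.BalabanUV.Beta.BorderedHessian (bhK bhK_inr_inr bhK_inl_inl_eq fcol tsum_bhK_inl_inl sgnK comp_sgnK codiff₁_wΦ_right
  exists_abs_wΦ_le stepScale)
open Summit.QuantumFields.BalabanUV.Beta.SymmetrisedAxialPotential
open Summit.QuantumFields.BalabanUV.Beta.SymmetrisedAxialGauge (symAxProjAt symLinAvgAt_symAxProjAt)
open Summit.QuantumFields.BalabanUV.Beta.SymmetrisedAxialGaugeBlockMean (symGaugeAt symAxProjAt_eq_sub)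
open Summit.QuantumFields.BalabanUV.Beta.SymRootedDressingKernel (piKSym piKSym_inl_inr)
open Summit.QuantumFields.BalabanUV.Beta.CombRootedAbsorbsSym (fcol_trK_piKSym_inl curv_symAxProjAt tsum_mul_piKSym_inl_inl comp_trK_piKSym_inr
  sgnK_trK_piKSym)
open Summit.QuantumFields.BalabanUV.Beta.SymShiftedSpread (bhKStepSh bhKStepSh_zero)
open Summit.QuantumFields.BalabanUV.Beta.DshAn1
open Summit.QuantumFields.BalabanUV.Beta.CombChartSpreadBlind (comp_bhK_add_Dsh_inr trK_bhKSym bhKStepSh_succ_inl_inl bhKStepSh_succ_inr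
  comp_bhKStepSh_succ_inr trK_bhKStepSh_succ)

namespace Summit.QuantumFields.BalabanUV.Beta.CombChartSpreadSymBlind

variable {d : ℕ}

/-! ## §2 Level `0`: `bhK + Dsh` is blind to the rooted symmetrised dressing -/

section Zero

variable {N : ℕ}

/-- [folklore] **K2 AT LEVEL `0`, RIGHT: `comp (bhK N + Dsh N) (trK (piKSym (ctr (d+1) N) N)) = bhK N + Dsh N`.**  Field rows: `d*d` kills the gradient
correction and the field row of `Dsh` vanishes; multiplier rows: B1's action lemma `comp_bhK_add_Dsh_inr` + `symLinAvgAt_symAxProjAt`;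
multiplier columns untouched. -/
theorem comp_bhKSym_trK_piKSym [NeZero N] :
    comp (bhK N + Dsh N) (trK (piKSym (ctr (d + 1) N) N)) = bhK N + Dsh (d := d) N := by
  have hN : 1 ≤ N := one_le_of_neZero N
  have hr : ctrOff (d + 1) N ∈ box (d + 1) N := ctrOff_mem_box hN
  rw [show ctr (d + 1) N = toSite (ctrOff (d + 1) N) from rfl]
  funext x z a b
  rcases b with β | μ
  · rcases a with κ | m
    · unfold ExpKernelCalculus.comp
      have e : ∀ y, ∑ f : Fib d, (bhK N + Dsh N : MKer (d + 1) (Fib d)) x y (Sum.inl κ) f * trK (piKSym (toSite (ctrOff (d + 1) N)) N) y z f (Sum.inl β)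
          = ∑ l : Fin (d + 1), bhK N x y (Sum.inl κ) (Sum.inl l) * trK (piKSym (toSite (ctrOff (d + 1) N)) N) y z (Sum.inl l) (Sum.inl β) := by
        intro y
        rw [Fintype.sum_sum_type]
        simp only [Pi.add_apply, Dsh_inl_inl, add_zero, trK_apply, piKSym_inl_inr, mul_zero, Finset.sum_const_zero]
      simp_rw [e]
      rw [tsum_bhK_inl_inl, fcol_trK_piKSym_inl hN hr, curv_symAxProjAt, ← bhK_inl_inl_eq N x z κ β]
      simp only [Pi.add_apply, Dsh_inl_inl, add_zero]
    · rw [comp_bhK_add_Dsh_inr, fcol_trK_piKSym_inl hN hr, bhK_add_Dsh_inr_inl,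
        show ctr (d + 1) N = toSite (ctrOff (d + 1) N) from rfl, symLinAvgAt_symAxProjAt hr]
  · exact comp_trK_piKSym_inr _ _ _ _ _ _ _

/-- [folklore] **K2 AT LEVEL `0`, LEFT**: `comp (piKSym (ctr (d+1) N) N) (bhK N + Dsh N) = bhK N + Dsh N` — by transposition (`trK_bhKSym`, `sgnK_trK_piKSym`). -/
theorem comp_piKSym_bhKSym [NeZero N] :
    comp (piKSym (ctr (d + 1) N) N) (bhK N + Dsh N) = bhK N + Dsh (d := d) N := by
  have h : trK (comp (piKSym (ctr (d + 1) N) N) (bhK N + Dsh N)) = trK (bhK N + Dsh (d := d) N) := by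
    rw [trK_comp, trK_bhKSym, ← sgnK_trK_piKSym, comp_sgnK, comp_bhKSym_trK_piKSym]
  have h' := congrArg trK h
  rwa [trK_trK, trK_trK] at h'

end Zero

/-! ## §3 Level `j + 1`: the shifted spread is blind to the rooted symmetrised dressing; every `j` -/

section Step

variable {Lc : ℕ} [NeZero Lc]

/-- [folklore] **K2 AT LEVEL `j + 1`, RIGHT: `comp (bhKStepSh d Lc (Dsh Lc) (j+1)) (trK (piKSym (ctr (d+1) Lc) Lc)) = bhKStepSh d Lc (Dsh Lc) (j+1)`.**
Field rows = bounded co-closed `wVH·wΦ` reproduced by `tsum_mul_piKSym_inl_inl`; multiplier rows = `stepScale ·` level `0`; multiplier columns untouched. -/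
theorem comp_bhKStepSh_succ_trK_piKSym (j : ℕ) :
    comp (bhKStepSh d Lc (Dsh Lc) (j + 1)) (trK (piKSym (ctr (d + 1) Lc) Lc)) = bhKStepSh d Lc (Dsh Lc) (j + 1) := by
  have hLc : 1 ≤ Lc := one_le_of_neZero Lc
  have hr : ctrOff (d + 1) Lc ∈ box (d + 1) Lc := ctrOff_mem_box hLc
  have h0 := comp_bhKSym_trK_piKSym (d := d) (N := Lc)
  rw [show ctr (d + 1) Lc = toSite (ctrOff (d + 1) Lc) from rfl] at h0 ⊢
  obtain ⟨C, hC⟩ := exists_abs_wΦ_le (N := Lc ^ (j + 1)) (d := d)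
  funext x z a b
  rcases b with β | μ
  · rcases a with κ | m
    · unfold ExpKernelCalculus.comp
      have e : ∀ y, ∑ f : Fib d, bhKStepSh d Lc (Dsh Lc) (j + 1) x y (Sum.inl κ) f * trK (piKSym (toSite (ctrOff (d + 1) Lc)) Lc) y z f (Sum.inl β)
          = wVH d Lc (j + 1) * ∑ l : Fin (d + 1),
              wΦ (N := Lc ^ (j + 1)) κ l (x - y) * piKSym (toSite (ctrOff (d + 1) Lc)) Lc z y (Sum.inl β) (Sum.inl l) := by
        intro y
        rw [Fintype.sum_sum_type, Finset.mul_sum]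
        simp only [trK_apply, piKSym_inl_inr, mul_zero, Finset.sum_const_zero, add_zero, bhKStepSh_succ_inl_inl, mul_assoc]
      simp_rw [e]
      rw [tsum_mul_left, tsum_mul_piKSym_inl_inl hLc hr (A := fun l y => wΦ (N := Lc ^ (j + 1)) κ l (x - y)) (fun l y => hC κ l (x - y))
        (codiff₁_wΦ_right κ x) z β, bhKStepSh_succ_inl_inl]
    · have h0' := congrFun (congrFun (congrFun (congrFun h0 x) z) (Sum.inr m)) (Sum.inl β)
      rw [comp_bhKStepSh_succ_inr, h0', bhKStepSh_succ_inr]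
  · exact comp_trK_piKSym_inr _ _ _ _ _ _ _

/-- [folklore] **K2 AT LEVEL `j + 1`, LEFT**: `comp (piKSym (ctr (d+1) Lc) Lc) (bhKStepSh d Lc (Dsh Lc) (j+1)) = bhKStepSh d Lc (Dsh Lc) (j+1)` — by
transposition (`trK_bhKStepSh_succ`, `sgnK_trK_piKSym`). -/
theorem comp_piKSym_bhKStepSh_succ (j : ℕ) :
    comp (piKSym (ctr (d + 1) Lc) Lc) (bhKStepSh d Lc (Dsh Lc) (j + 1)) = bhKStepSh d Lc (Dsh Lc) (j + 1) := by
  have h : trK (comp (piKSym (ctr (d + 1) Lc) Lc) (bhKStepSh d Lc (Dsh Lc) (j + 1))) = trK (bhKStepSh d Lc (Dsh Lc) (j + 1)) := by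
    rw [trK_comp, trK_bhKStepSh_succ, ← sgnK_trK_piKSym, comp_sgnK, comp_bhKStepSh_succ_trK_piKSym]
  have h' := congrArg trK h
  rwa [trK_trK, trK_trK] at h'

/-- [folklore] **K2, RIGHT, EVERY LEVEL**: `comp (bhKStepSh d Lc (Dsh Lc) j) (trK (piKSym (ctr (d+1) Lc) Lc)) = bhKStepSh d Lc (Dsh Lc) j` — the hypothesis
`hMS` of `RelInvBlindTransport.relInv_transport_of_blind` at `S := trK (piKSym (ctr) Lc)`. -/
theorem comp_bhKStepSh_trK_piKSym : ∀ j : ℕ,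
    comp (bhKStepSh d Lc (Dsh Lc) j) (trK (piKSym (ctr (d + 1) Lc) Lc)) = bhKStepSh d Lc (Dsh Lc) j
  | 0 => by rw [bhKStepSh_zero]; exact comp_bhKSym_trK_piKSym
  | j + 1 => comp_bhKStepSh_succ_trK_piKSym j

/-- [folklore] **K2, LEFT, EVERY LEVEL**: `comp (piKSym (ctr (d+1) Lc) Lc) (bhKStepSh d Lc (Dsh Lc) j) = bhKStepSh d Lc (Dsh Lc) j` — the hypothesis `hStM`
at `St := piKSym (ctr) Lc`. -/
theorem comp_piKSym_bhKStepSh : ∀ j : ℕ,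
    comp (piKSym (ctr (d + 1) Lc) Lc) (bhKStepSh d Lc (Dsh Lc) j) = bhKStepSh d Lc (Dsh Lc) j
  | 0 => by rw [bhKStepSh_zero]; exact comp_piKSym_bhKSym
  | j + 1 => comp_piKSym_bhKStepSh_succ j

end Step

end Summit.QuantumFields.BalabanUV.Beta.CombChartSpreadSymBlind

end
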